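import Literature.MathematicalPhysics.QuantumLattice.AndersonHeisenbergStarBound
import Literature.MathematicalPhysics.QuantumLattice.HeisenbergCorrelationGramWindows
import Literature.MathematicalPhysics.QuantumLattice.HeisenbergOrderNeelShortRange
import HarnessLib

/-!
# The total spin of `k` spins ½ and the integer spectrum of the Heisenberg star

Trunk T-QLATTICE; sibling of `SpinHalfCasimirBound.lean` (the Casimir UPPER bound `𝐋² ≤ k(k+2)/4`)
and `AndersonHeisenbergStarBound.lean` (`G² = ¼𝐋² - ½G` for the star `G = 𝐒_x·𝐋_Y`). Here the
full spectral statement behind both is proved, inside an arbitrary finite spin-½ system `Λ`: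

* `spectrum_setSpinSq_subset`: **the total spin of `k = |Y|` spins ½ takes the values
  `S ∈ {k/2, k/2 - 1, …} ∩ [0, ∞)`**, i.e. every spectral value of `𝐋_Y² = Σ_α (Σ_{y∈Y} Sᵅ_y)²` is
  `S(S+1)` with `2S ≤ k`, `2S ≡ k (mod 2)` (Lieb–Mattis 1962; Tasaki 2020 §2.2, eq. (2.2.12), and
  App. A.3); `spectrum_totalSpinSq_one_subset` is the case `Y = Λ` for the
  tree's `totalSpinSq 1`. Proof by induction on `Y` through the Heisenberg star of a site `x ∉ Y`:
  `𝐋_Y² = 4G² + 2G` (`heisStar_mul_self`) and `𝐋_{Y∪{x}}² = 𝐋_Y² + 2G + ¾`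
  (`setSpinSq_insert`), the spectral mapping theorem for polynomials, and positivity of
  `𝐋_{Y∪{x}}²` (which removes the spurious branch `2G = -1` on the singlet sector of `Y`).
* `twice_heisStar_spectrum` (Anderson 1951): hence **`spec(2G) ⊆ {S, -S-1}`** — integers when `k`
  is even, half-odd integers `≠ -½` when `k` is odd — and therefore the operator inequalities
  (`posSemidef_heisStar_row`, `_even`, `_odd`, `posSemidef_setSpinSq_sub_of_odd`)
  **`(2G + a)(2G + b) = 𝐋_Y² + (2a+2b-2)G + ab ⪰ 0`** whenever no admissible value of `2G` lies
  strictly between `-b` and `-a`: `𝐋_Y² + 4nG + n(n+1) ⪰ 0` (`k` even, `n ∈ ℤ`),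
  `𝐋_Y² + (4n+2)G + (n+½)(n+3/2) ⪰ 0` (`k` odd), `𝐋_Y² ⪰ ¾` (`k` odd). At `k = 1` these are the
  singlet and triplet bounds `-¾ ≤ 𝐒_x·𝐒_y ≤ ¼`; at `k = 4`, `n = 2` the row reads
  `𝐋² + 8𝐒_x·𝐋 + 6 ⪰ 0`, at `n = -2` it reads `𝐋² - 8𝐒_x·𝐋 + 2 ⪰ 0`.
* `heis_starRow_nat` (`_even`, `_odd`): in the ground state of the Heisenberg
  antiferromagnet on the torus `(ℤ/Lℤ)²` (`⟨𝐒_0·𝐒_r⟩₀ = 3c(r)`, `c(a,b) = heisRedCorr2 L 1 a b`)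
  each row is a LINEAR inequality in the two-point function — for arms `P` and centre `c` given in
  window coordinates `< L`: `0 ≤ ¾|P| + ab + (2a+2b-2)·3Σ_{p∈P} c(c-p) + 3Σ_{p≠p'∈P} c(p-p')`.
  These are inputs of the finite-volume linear programmes over `c(a,b)` (HubbardLadder R2 rows),
  complementing the Gram windows (`HeisenbergCorrelationGramWindows`), the triplet bound
  (`HeisenbergTorusTripletBound`) and the Marshall signs (`HeisenbergMarshallSameSublattice`).

Tool (private `posSemidef_aeval_of_eval_nonneg`): a real polynomial that is nonnegative
on the real spectrum of a Hermitian matrix evaluates to a positive semidefinite matrix (Mathlib's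
continuous functional calculus, `cfc_polynomial` / `cfc_nonneg`). No definition and no notation is
introduced (the sums `𝐋_Y²`, `G_{x,Y}` and the window sites are spelled out, as in
`AndersonHeisenbergStarBound`).
Deliberately NOT here: the multiplicities of the total-spin values (the full Clebsch–Gordan
decomposition), and stars with non-uniform couplings.

## References

* [LiebMattis1962] E. Lieb, D. Mattis, *Ordering energy levels of interacting spin systems*,
  J. Math. Phys. 3 (1962) 749 (total spin of spin systems).
* [Anderson1951] P. W. Anderson, *Limits on the Energy of the Antiferromagnetic Ground State*,
  Phys. Rev. 83 (1951) 1260 (the star `𝐒_x·𝐋`, its extreme eigenvalues `-(k+2)/4` and `k/4`).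
* [Tasaki2020] H. Tasaki, *Physics and Mathematics of Quantum Many-Body Systems* (2020), §2.2
  (eq. (2.2.12): the eigenvalues `S(S+1)` of `(Ŝ_tot)²`, `S ∈ {Smax, Smax - 1, …}`), App. A.3.
* [KLS1988JSP] T. Kennedy, E. H. Lieb, B. S. Shastry, J. Stat. Phys. 53 (1988) 1019, p. 1021
  (the two-point function of the torus antiferromagnet).
-/

noncomputable section

open Matrix Complex Finset Polynomial
open scoped ComplexOrder Matrix.Norms.L2Operator MatrixOrder

namespace Literature.MathematicalPhysics.QuantumLattice

open SpinOperators

variable {Λ : Type*} [Fintype Λ] [DecidableEq Λ]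

/-- `Σ_{y∈Y} Sᵅ_y` is Hermitian. [folklore] -/
private theorem setSpin_isHermitian (Y : Finset Λ) (α : Fin 3) :
    (∑ y ∈ Y, siteSpin 1 y α : Op Λ 2).IsHermitian := by
  rw [IsHermitian, conjTranspose_sum]
  exact Finset.sum_congr rfl fun y _ => (siteSpin_isHermitian 1 y α).eq

/-- `𝐋_Y² ⪰ 0` (a sum of squares of Hermitian operators). [cite: Tasaki2020, §2.2 eq. (2.2.13)] -/
theorem posSemidef_setSpinSq (Y : Finset Λ) : (∑ α : Fin 3, (∑ y ∈ Y, siteSpin 1 y α) * (∑ y ∈ Y,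
      siteSpin 1 y α) : Op _ 2).PosSemidef := by
  refine posSemidef_finset_sum _ fun α _ => ?_
  have h := (setSpin_isHermitian (Λ := Λ) Y α).eq
  nth_rewrite 1 [← h]
  exact posSemidef_conjTranspose_mul_self _

/-- `𝐋_Y²` is Hermitian. [folklore] -/
private theorem setSpinSq_isHermitian (Y : Finset Λ) : (∑ α : Fin 3, (∑ y ∈ Y, siteSpin 1 y α)
      * (∑ y ∈ Y, siteSpin 1 y α) : Op _ 2).IsHermitian :=
  (posSemidef_setSpinSq Y).isHermitian

/-- `𝐋_Y² = 4G² + 2G` for `x ∉ Y` (`heisStar_mul_self`). [cite: Anderson1951, eq. (4)] -/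
theorem setSpinSq_eq_heisStar {x : Λ} {Y : Finset Λ} (hx : x ∉ Y) :
    (∑ α : Fin 3, (∑ y ∈ Y, siteSpin 1 y α) * (∑ y ∈ Y, siteSpin 1 y α) : Op _ 2)
          = (4 : ℂ) • ((∑ y ∈ Y, spinDot 1 x y : Op _ 2) * (∑ y ∈ Y, spinDot 1 x y : Op _ 2))
          + (2 : ℂ) • (∑ y ∈ Y, spinDot 1 x y : Op _ 2) := by
  have h := heisStar_mul_self hx
  rw [h]
  module

/-- The insertion recursion `𝐋_{Y∪{x}}² = 𝐋_Y² + 2G_{x,Y} + ¾` (`x ∉ Y`).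
[cite: Anderson1951, eq. (4)] -/
theorem setSpinSq_insert {x : Λ} {Y : Finset Λ} (hx : x ∉ Y) :
    (∑ α : Fin 3, (∑ y ∈ insert x Y, siteSpin 1 y α) * (∑ y ∈ insert x Y, siteSpin 1 y α)
          : Op _ 2) = (∑ α : Fin 3, (∑ y ∈ Y, siteSpin 1 y α) * (∑ y ∈ Y, siteSpin 1 y α)
          : Op _ 2) + (2 : ℂ) • (∑ y ∈ Y, spinDot 1 x y : Op _ 2) + (3 / 4 : ℂ) • 1 := by
  have hc : ∀ α : Fin 3, (∑ y ∈ Y, siteSpin 1 y α : Op Λ 2) * siteSpin 1 x α =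
      siteSpin 1 x α * ∑ y ∈ Y,
            siteSpin 1 y α := fun α => (siteSpin_commute_setSpin 1 hx α α).eq.symm
  simp only [Finset.sum_insert hx, Matrix.add_mul, Matrix.mul_add, hc, siteSpin_one_mul_self,
    Finset.sum_add_distrib]
  rw [heisStar_eq_sum 1 hx, Finset.sum_const, Finset.card_univ, Fintype.card_fin]
  module

omit [Fintype Λ] [DecidableEq Λ] in
/-- Real scalars act on operators through `ℝ → ℂ`. [folklore] -/
private theorem real_smul_op (r : ℝ) (M : Op Λ 2) : r • M = (r : ℂ) • M := by
  ext i j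
  simp [Matrix.smul_apply, Complex.real_smul]

/-! ### Spectra -/

/-- Real spectrum = real points of the complex spectrum (`spectrum.algebraMap_mem_iff`).
[folklore] -/
private theorem mem_spectrum_real_iff' (A : Op Λ 2) (x : ℝ) :
    x ∈ spectrum ℝ A ↔ (x : ℂ) ∈ spectrum ℂ A := by
  rw [← spectrum.preimage_algebraMap (S := ℂ)]
  rfl

/-- The complex spectrum of a Hermitian operator consists of real numbers in its real spectrum.
[folklore] -/
private theorem exists_real_of_mem_spectrum [Nonempty Λ] {A : Op Λ 2} (hA : A.IsHermitian) {z : ℂ}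
    (hz : z ∈ spectrum ℂ A) : ∃ x : ℝ, x ∈ spectrum ℝ A ∧ (x : ℂ) = z := by
  rw [hA.spectrum_eq_image_range] at hz
  obtain ⟨x, hx, rfl⟩ := hz
  refine ⟨x, ?_, rfl⟩
  rw [hA.spectrum_real_eq_range_eigenvalues]
  exact hx

/-- PSD operators have nonnegative real spectrum. [folklore] -/
private theorem spectrum_nonneg_of_posSemidef'' {A : Op Λ 2} (hA : A.PosSemidef) :
    ∀ x ∈ spectrum ℝ A, 0 ≤ x := by
  intro x hx
  rw [hA.isHermitian.spectrum_real_eq_range_eigenvalues] at hx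
  obtain ⟨i, rfl⟩ := hx
  exact hA.eigenvalues_nonneg i

/-- Step lemma: if `spec 𝐋_Y² ⊆` total-spin values of `k = |Y|`, then `spec (2G) ⊆` twice-star
values.
[cite: Anderson1951, eq. (4)] -/
theorem twice_heisStar_spectrum_step [Nonempty Λ] {x : Λ} {Y : Finset Λ} (hx : x ∉ Y)
    (hY : ∀ t ∈ spectrum ℝ (∑ α : Fin 3, (∑ y ∈ Y, siteSpin 1 y α) * (∑ y ∈ Y, siteSpin 1 y α)
          : Op _ 2), (∃ j : ℕ, j ≤ Y.card ∧ j % 2 = Y.card % 2 ∧ t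
          = (j : ℝ) / 2 * ((j : ℝ) / 2 + 1)))
    {g : ℝ} (hg : g ∈ spectrum ℝ (∑ y ∈ Y, spinDot 1 x y : Op _ 2)) : (∃ j : ℕ, j ≤ Y.card
          ∧ j % 2 = Y.card % 2 ∧ (2 * g
          = (j : ℝ) / 2 ∨ 2 * g = -((j : ℝ) / 2) - 1)) := by
  -- forward spectral inclusion over ℝ for the polynomial 4X²+2X
  have hC : (∑ α : Fin 3, (∑ y ∈ Y, siteSpin 1 y α) * (∑ y ∈ Y, siteSpin 1 y α) : Op _ 2)
        = aeval (∑ y ∈ Y, spinDot 1 x y : Op _ 2) ((4 : ℝ) • X ^ 2 + (2 : ℝ) • X : ℝ[X]) := by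
    rw [setSpinSq_eq_heisStar hx]
    simp [pow_two, Algebra.smul_def]
    rfl
  have hmem : (4 * g ^ 2 + 2 * g) ∈ spectrum ℝ (∑ α : Fin 3, (∑ y ∈ Y, siteSpin 1 y α)
        * (∑ y ∈ Y, siteSpin 1 y α) : Op _ 2) := by
    have := spectrum.subset_polynomial_aeval (∑ y ∈ Y, spinDot 1 x y : Op _ 2) ((4 : ℝ) • X ^ 2
          + (2 : ℝ) • X : ℝ[X])
      ⟨g, hg, rfl⟩
    rw [← hC] at this
    simpa using this
  obtain ⟨j, hj, hpar, ht⟩ := hY _ hmem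
  refine ⟨j, hj, hpar, ?_⟩
  have hfac : (2 * g - (j : ℝ) / 2) * (2 * g + (j : ℝ) / 2 + 1) = 0 := by nlinarith [ht]
  rcases mul_eq_zero.mp hfac with h | h
  · left; linarith
  · right; linarith

/-- If `q ≥ 0` on the real spectrum of a Hermitian matrix `A`, then `q(A) ⪰ 0` (continuous
functional
calculus). [folklore] -/
private theorem posSemidef_aeval_of_eval_nonneg {n : Type*} [Fintype n]
    [DecidableEq n]
    {A : Matrix n n ℂ} (hA : A.IsHermitian) (q : ℝ[X]) (h : ∀ x ∈ spectrum ℝ A, 0 ≤ q.eval x) :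
    (aeval A (q.map (algebraMap ℝ ℂ))).PosSemidef := by
  have hsa : IsSelfAdjoint A := hA.isSelfAdjoint
  have h1 : cfc (fun x : ℝ => q.eval x) A = aeval A q := cfc_polynomial q A
  have h2 : (0 : Matrix n n ℂ) ≤ cfc (fun x : ℝ => q.eval x) A := cfc_nonneg (fun x hx => h x hx)
  rw [h1] at h2
  rw [aeval_map_algebraMap]
  simpa [Matrix.le_iff] using h2

/-- **The total-spin spectrum of `k` spins ½**: every spectral value of `𝐋_Y²` is `ℓ(ℓ+1)` with
`ℓ ∈ {k/2, k/2 - 1, …}`, `ℓ ≥ 0`. Tasaki (2020) §2.2, App. A.3.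
[cite: Tasaki2020, §2.2 eq. (2.2.12) and App. A.3] -/
theorem spectrum_setSpinSq_subset [Nonempty Λ] (Y : Finset Λ) :
    ∀ t ∈ spectrum ℝ (∑ α : Fin 3, (∑ y ∈ Y, siteSpin 1 y α) * (∑ y ∈ Y, siteSpin 1 y α)
          : Op _ 2), (∃ j : ℕ, j ≤ Y.card ∧ j % 2 = Y.card % 2 ∧ t
          = (j : ℝ) / 2 * ((j : ℝ) / 2 + 1)) := by
  induction Y using Finset.induction_on with
  | empty =>
    intro t ht
    have h0 : ((∑ α : Fin 3, (∑ y ∈ (∅ : Finset Λ), siteSpin 1 y α) * (∑ y ∈ (∅ : Finset Λ),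
          siteSpin 1 y α) : Op _ 2) : Op Λ 2) = 0 := by simp
    rw [h0, spectrum.zero_eq, Set.mem_singleton_iff] at ht
    exact ⟨0, le_rfl, rfl, by simp [ht]⟩
  | insert x Y hx ih =>
    intro t ht
    rw [Finset.card_insert_of_notMem hx]
    have hC' : (∑ α : Fin 3, (∑ y ∈ insert x Y, siteSpin 1 y α) * (∑ y ∈ insert x Y,
          siteSpin 1 y α) : Op _ 2) =
        aeval (∑ y ∈ Y, spinDot 1 x y : Op _ 2) (C (4 : ℂ) * X ^ 2 + C (4 : ℂ) * X
              + C (3 / 4 : ℂ)) := by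
      rw [setSpinSq_insert hx, setSpinSq_eq_heisStar hx]
      simp only [map_add, map_mul, aeval_C, aeval_X, Algebra.algebraMap_eq_smul_one,
        smul_mul_assoc, one_mul, pow_two]
      module
    have hdeg : 0 < (C (4 : ℂ) * X ^ 2 + C (4 : ℂ) * X + C (3 / 4 : ℂ)).degree := by
      rw [Polynomial.degree_quadratic (by norm_num)]
      norm_num
    have htC : (t : ℂ) ∈ spectrum ℂ ((∑ α : Fin 3, (∑ y ∈ insert x Y, siteSpin 1 y α)
          * (∑ y ∈ insert x Y, siteSpin 1 y α) : Op _ 2)) := (mem_spectrum_real_iff' _ _).mp ht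
    rw [hC', spectrum.map_polynomial_aeval_of_degree_pos _ _ hdeg] at htC
    obtain ⟨z, hz, hzt⟩ := htC
    obtain ⟨g, hg, rfl⟩ := exists_real_of_mem_spectrum (heisStar_isHermitian 1 x Y) hz
    obtain ⟨j, hj, hpar, hs⟩ := twice_heisStar_spectrum_step hx ih hg
    have ht' : t = 4 * g ^ 2 + 4 * g + 3 / 4 := by
      simp only [eval_add, eval_mul, eval_C, eval_X, eval_pow] at hzt
      have h' : ((4 * g ^ 2 + 4 * g + 3 / 4 : ℝ) : ℂ) = (t : ℂ) := by
        rw [← hzt]; push_cast; ring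
      exact_mod_cast h'.symm
    have hnn : 0 ≤ t := spectrum_nonneg_of_posSemidef'' (posSemidef_setSpinSq _) t ht
    rcases hs with hs | hs
    · refine ⟨j + 1, by omega, by omega, ?_⟩
      have hg' : g = (j : ℝ) / 4 := by linarith
      rw [ht', hg']; push_cast; ring
    · have hg' : g = -((j : ℝ) / 4) - 1 / 2 := by linarith
      have hj1 : 1 ≤ j := by
        rcases Nat.eq_zero_or_pos j with h0 | h0
        · exfalso
          rw [h0] at hg'
          norm_num at hg'
          rw [ht', hg'] at hnn
          norm_num at hnn
        · exact h0
      refine ⟨j - 1, by omega, by omega, ?_⟩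
      rw [ht', hg', Nat.cast_sub hj1]; push_cast; ring

/-- The case `Y = Λ`: every spectral value of the tree's total-spin Casimir `(𝐒_tot)²` of
`N = |Λ|` spins ½ (`totalSpinSq 1`) is `S(S+1)` with `2S ≤ N`, `2S ≡ N (mod 2)`.
Tasaki (2020) §2.2, eqs. (2.2.12)–(2.2.13). [cite: Tasaki2020, §2.2 eq. (2.2.12)] -/
theorem spectrum_totalSpinSq_one_subset [Nonempty Λ] :
    ∀ t ∈ spectrum ℝ (totalSpinSq 1 : Op Λ 2), (∃ j : ℕ, j ≤ Fintype.card Λ ∧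
      j % 2 = Fintype.card Λ % 2 ∧ t = (j : ℝ) / 2 * ((j : ℝ) / 2 + 1)) := by
  have h : (totalSpinSq 1 : Op Λ 2) = (∑ α : Fin 3, (∑ y ∈ (Finset.univ : Finset Λ),
        siteSpin 1 y α) * (∑ y ∈ (Finset.univ : Finset Λ), siteSpin 1 y α) : Op _ 2) := rfl
  rw [h, ← Finset.card_univ]
  exact spectrum_setSpinSq_subset _

/-- The spectrum of `2G_{x,Y}` (`x ∉ Y`, `k = |Y|`) lies in `{j/2, -j/2-1 : j ≤ k, j ≡ k (2)}`:
integers for even `k`, half-odd-integers `≠ -½` for odd `k`. [cite: Anderson1951] -/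
theorem twice_heisStar_spectrum [Nonempty Λ] {x : Λ} {Y : Finset Λ} (hx : x ∉ Y)
    {g : ℝ} (hg : g ∈ spectrum ℝ (∑ y ∈ Y, spinDot 1 x y : Op _ 2)) : (∃ j : ℕ, j ≤ Y.card
          ∧ j % 2 = Y.card % 2 ∧ (2 * g
          = (j : ℝ) / 2 ∨ 2 * g = -((j : ℝ) / 2) - 1)) :=
  twice_heisStar_spectrum_step hx (spectrum_setSpinSq_subset Y) hg

/-- **Generic star row**: `𝐋_Y² + (2a+2b-2)G + ab = (2G+a)(2G+b) ⪰ 0` whenever `(s+a)(s+b) ≥ 0` on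
the admissible values `s` of `2G`. [cite: Anderson1951, eq. (4)] -/
theorem posSemidef_heisStar_row [Nonempty Λ] {x : Λ} {Y : Finset Λ} (hx : x ∉ Y) (a b : ℝ)
    (hab : ∀ s : ℝ, (∃ j : ℕ, j ≤ Y.card ∧ j % 2 = Y.card % 2 ∧ (s = (j : ℝ) / 2 ∨ s
          = -((j : ℝ) / 2) - 1)) → 0 ≤ (s + a) * (s + b)) :
    ((∑ α : Fin 3, (∑ y ∈ Y, siteSpin 1 y α) * (∑ y ∈ Y, siteSpin 1 y α) : Op _ 2) + ((2 * a + 2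
          * b - 2 : ℝ) : ℂ) • (∑ y ∈ Y, spinDot 1 x y : Op _ 2) +
      ((a * b : ℝ) : ℂ) • (1 : Op Λ 2)).PosSemidef := by
  set q : ℝ[X] := C 4 * X ^ 2 + C (2 * a + 2 * b) * X + C (a * b) with hq_def
  have hq : (∑ α : Fin 3, (∑ y ∈ Y, siteSpin 1 y α) * (∑ y ∈ Y, siteSpin 1 y α) : Op _ 2) + ((2
        * a + 2 * b - 2 : ℝ) : ℂ) • (∑ y ∈ Y, spinDot 1 x y : Op _ 2) +
      ((a * b : ℝ) : ℂ) • (1 : Op Λ 2) = aeval (∑ y ∈ Y, spinDot 1 x y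
            : Op _ 2) (q.map (algebraMap ℝ ℂ)) := by
    rw [setSpinSq_eq_heisStar hx, aeval_map_algebraMap, hq_def]
    simp only [map_add, map_mul, aeval_C, aeval_X, Algebra.algebraMap_eq_smul_one,
      real_smul_op, smul_mul_assoc, one_mul, pow_two, Complex.ofReal_add, Complex.ofReal_mul,
      Complex.ofReal_sub, Complex.ofReal_ofNat, add_mul, smul_smul]
    module
  rw [hq]
  refine posSemidef_aeval_of_eval_nonneg (heisStar_isHermitian 1 x Y) q fun g hg => ?_
  have h := hab (2 * g) (twice_heisStar_spectrum hx hg)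
  simp only [hq_def, eval_add, eval_mul, eval_C, eval_X, eval_pow]
  nlinarith [h]

/-! ### The arithmetic of the three row families -/

/-- `z(z+1) ≥ 0` for an integer `z`. [folklore] -/
private theorem int_mul_add_one_nonneg (z : ℤ) : (0 : ℝ) ≤ (z : ℝ) * ((z : ℝ) + 1) := by
  have h : (0 : ℤ) ≤ z * (z + 1) := by
    rcases le_or_gt 0 z with h | h
    · exact mul_nonneg h (by linarith)
    · exact mul_nonneg_of_nonpos_of_nonpos h.le (by linarith)
  exact_mod_cast h

/-- `(z-1)(z+1) ≥ 0` for a nonzero integer `z`. [folklore] -/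
private theorem int_sq_sub_one_nonneg {z : ℤ} (hz : z ≠ 0) : (0 : ℝ) ≤ ((z : ℝ) - 1) * ((z : ℝ)
      + 1) := by
  have h : (0 : ℤ) ≤ (z - 1) * (z + 1) := by
    rcases lt_or_gt_of_ne hz with h | h
    · exact mul_nonneg_of_nonpos_of_nonpos (by linarith) (by linarith)
    · exact mul_nonneg (by linarith) (by linarith)
  exact_mod_cast h

/-- Even `k`: `2G ∈ ℤ`, so `(2G + n)(2G + n + 1) ≥ 0` pointwise. [folklore] -/
private theorem starRow_arith_even {k : ℕ} (hk : k % 2 = 0) (n : ℤ) (s : ℝ) (hs : (∃ j : ℕ, j ≤ k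
      ∧ j % 2
      = k % 2 ∧ (s = (j : ℝ) / 2 ∨ s = -((j : ℝ) / 2) - 1))) :
    0 ≤ (s + n) * (s + (n + 1)) := by
  obtain ⟨j, hj, hpar, hs⟩ := hs
  obtain ⟨m, rfl⟩ : ∃ m, j = 2 * m := ⟨j / 2, by omega⟩
  rcases hs with rfl | rfl
  · have := int_mul_add_one_nonneg ((m : ℤ) + n)
    push_cast at this ⊢
    nlinarith [this]
  · have := int_mul_add_one_nonneg (-(m : ℤ) - 1 + n)
    push_cast at this ⊢
    nlinarith [this]

/-- Odd `k`: `2G + ½ ∈ ℤ`, so `(2G + n + ½)(2G + n + 3/2) ≥ 0` pointwise. [folklore] -/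
private theorem starRow_arith_odd {k : ℕ} (hk : k % 2 = 1) (n : ℤ) (s : ℝ) (hs : (∃ j : ℕ, j ≤ k
      ∧ j % 2
      = k % 2 ∧ (s = (j : ℝ) / 2 ∨ s = -((j : ℝ) / 2) - 1))) :
    0 ≤ (s + (n + 1 / 2)) * (s + (n + 3 / 2)) := by
  obtain ⟨j, hj, hpar, hs⟩ := hs
  obtain ⟨m, rfl⟩ : ∃ m, j = 2 * m + 1 := ⟨j / 2, by omega⟩
  rcases hs with rfl | rfl
  · have := int_mul_add_one_nonneg ((m : ℤ) + n + 1)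
    push_cast at this ⊢
    nlinarith [this]
  · have := int_mul_add_one_nonneg (-(m : ℤ) - 1 + n)
    push_cast at this ⊢
    nlinarith [this]

/-- **Star rows, even arm number**: `𝐋_Y² + 4n·G_{x,Y} + n(n+1) ⪰ 0` (`x ∉ Y`, `|Y|` even, `n ∈ ℤ`).
[cite: Anderson1951, eq. (4)] -/
theorem posSemidef_heisStar_row_even [Nonempty Λ] {x : Λ} {Y : Finset Λ} (hx : x ∉ Y)
    (hk : Y.card % 2 = 0) (n : ℤ) :
    ((∑ α : Fin 3, (∑ y ∈ Y, siteSpin 1 y α) * (∑ y ∈ Y, siteSpin 1 y α) : Op _ 2) + ((4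
          * n : ℝ) : ℂ) • (∑ y ∈ Y, spinDot 1 x y : Op _ 2) +
      ((n * (n + 1) : ℝ) : ℂ) • (1 : Op Λ 2)).PosSemidef := by
  have h := posSemidef_heisStar_row hx (n : ℝ) ((n : ℝ)
        + 1) fun s hs => starRow_arith_even hk n s hs
  have e1 : (2 * (n : ℝ) + 2 * ((n : ℝ) + 1) - 2) = 4 * n := by ring
  rw [e1] at h
  exact h

/-- **Star rows, odd arm number**: `𝐋_Y² + (4n+2)·G_{x,Y} + (n+½)(n+3/2) ⪰ 0`.
[cite: Anderson1951, eq. (4)] -/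
theorem posSemidef_heisStar_row_odd [Nonempty Λ] {x : Λ} {Y : Finset Λ} (hx : x ∉ Y)
    (hk : Y.card % 2 = 1) (n : ℤ) :
    ((∑ α : Fin 3, (∑ y ∈ Y, siteSpin 1 y α) * (∑ y ∈ Y, siteSpin 1 y α) : Op _ 2) + ((4 * n
          + 2 : ℝ) : ℂ) • (∑ y ∈ Y, spinDot 1 x y : Op _ 2) +
      (((n + 1 / 2) * (n + 3 / 2) : ℝ) : ℂ) • (1 : Op Λ 2)).PosSemidef := by
  have h := posSemidef_heisStar_row hx ((n : ℝ) + 1 / 2) ((n : ℝ) + 3 / 2)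
    fun s hs => starRow_arith_odd hk n s hs
  have e1 : (2 * ((n : ℝ) + 1 / 2) + 2 * ((n : ℝ) + 3 / 2) - 2) = 4 * n + 2 := by ring
  rw [e1] at h
  exact h

/-- **Total spin of an odd set is at least ½**: `𝐋_Y² - ¾ ⪰ 0` for `|Y|` odd.
[cite: Tasaki2020, §2.2 eq. (2.2.12)] -/
theorem posSemidef_setSpinSq_sub_of_odd [Nonempty Λ] (Y : Finset Λ) (hk : Y.card % 2 = 1) :
    ((∑ α : Fin 3, (∑ y ∈ Y, siteSpin 1 y α) * (∑ y ∈ Y, siteSpin 1 y α)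
          : Op _ 2) - (3 / 4 : ℂ) • (1 : Op Λ 2)).PosSemidef := by
  have hq : (∑ α : Fin 3, (∑ y ∈ Y, siteSpin 1 y α) * (∑ y ∈ Y, siteSpin 1 y α)
        : Op _ 2) - (3 / 4 : ℂ) • (1 : Op Λ 2) =
      aeval (∑ α : Fin 3, (∑ y ∈ Y, siteSpin 1 y α) * (∑ y ∈ Y, siteSpin 1 y α)
            : Op _ 2) ((X - C (3 / 4 : ℝ)).map (algebraMap ℝ ℂ)) := by
    rw [aeval_map_algebraMap]
    simp only [map_sub, aeval_X, aeval_C, Algebra.algebraMap_eq_smul_one,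
      real_smul_op]
    push_cast
    module
  rw [hq]
  refine posSemidef_aeval_of_eval_nonneg (setSpinSq_isHermitian Y) _ fun t ht => ?_
  obtain ⟨j, hj, hpar, rfl⟩ := spectrum_setSpinSq_subset Y t ht
  obtain ⟨m, rfl⟩ : ∃ m, j = 2 * m + 1 := ⟨j / 2, by omega⟩
  simp only [eval_sub, eval_X, eval_C]
  push_cast
  nlinarith [sq_nonneg (m : ℝ), (show (0:ℝ) ≤ m from Nat.cast_nonneg m)]

/-! ### The star rows in the ground state of the torus antiferromagnet, window coordinates -/

section Torus

open Literature.Probability.LatticeModels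

/-- Window points with coordinates `< L` give distinct sites of `(ℤ/Lℤ)²`. [folklore] -/
private theorem windowSite_injOn (L : ℕ) [NeZero L] {S : Finset (ℕ × ℕ)} (hS : ∀ p ∈ S, p.1 < L
      ∧ p.2 < L) :
    Set.InjOn (fun p : ℕ × ℕ => (![((p : ℕ × ℕ).1 : ZMod L),
          ((p : ℕ × ℕ).2 : ZMod L)] : TorusSite 2 L)) S := by
  intro p hp q hq h
  have h1 := congrFun h 0
  have h2 := congrFun h 1
  simp only [Matrix.cons_val_zero, Matrix.cons_val_one] at h1 h2
  rw [ZMod.natCast_eq_natCast_iff'] at h1 h2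
  obtain ⟨hp1, hp2⟩ := hS p hp
  obtain ⟨hq1, hq2⟩ := hS q hq
  rw [Nat.mod_eq_of_lt hp1, Nat.mod_eq_of_lt hq1] at h1
  rw [Nat.mod_eq_of_lt hp2, Nat.mod_eq_of_lt hq2] at h2
  exact Prod.ext h1 h2

/-- `re ω(𝐒_y·𝐒_{y'}) = 3 c(|Δ₁|, |Δ₂|)` for distinct window points. [cite: KLS1988JSP, p. 1021] -/
theorem re_groundStateFunctional_spinDot_window (L : ℕ) [NeZero L] {p q : ℕ × ℕ}
    (hpq : (![((p : ℕ × ℕ).1 : ZMod L),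
          ((p : ℕ × ℕ).2 : ZMod L)] : TorusSite 2 L) ≠ (![((q : ℕ × ℕ).1 : ZMod L),
          ((q : ℕ × ℕ).2 : ZMod L)] : TorusSite 2 L)) :
    ((heisenbergTorus 2 L 1 1).groundStateFunctional (spinDot 1 ((![((p : ℕ × ℕ).1 : ZMod L),
          ((p : ℕ × ℕ).2 : ZMod L)] : TorusSite 2 L)) ((![((q : ℕ × ℕ).1 : ZMod L),
          ((q : ℕ × ℕ).2 : ZMod L)] : TorusSite 2 L)))).re =
      3 * heisRedCorr2 L 1 (Int.natAbs ((p.1 : ℤ) - q.1)) (Int.natAbs ((p.2 : ℤ) - q.2)) := by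
  rw [spinDot_eq_sum_mul_of_ne 1 hpq, map_sum, ← groundStateSpinCorrTorus_of_neZero,
    groundStateSpinCorrTorus_one_eq_three_mul, heisGroundCorr_eq_zero_left 0 L 1]
  have hsub : (![((q : ℕ × ℕ).1 : ZMod L),
        ((q : ℕ × ℕ).2 : ZMod L)] : TorusSite 2 L) - (![((p : ℕ × ℕ).1 : ZMod L),
        ((p : ℕ × ℕ).2 : ZMod L)] : TorusSite 2 L) =
      ![(q.1 : ZMod L) - (p.1 : ZMod L), (q.2 : ZMod L) - (p.2 : ZMod L)] := by
    ext j; fin_cases j <;> simp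
  rw [hsub, heisGroundCorr_zero_natCast_sub_sub,
    show Int.natAbs ((q.1 : ℤ) - p.1) = Int.natAbs ((p.1 : ℤ) - q.1) by rw [← neg_sub,
          Int.natAbs_neg],
    show Int.natAbs ((q.2 : ℤ) - p.2) = Int.natAbs ((p.2 : ℤ) - q.2) by rw [← neg_sub,
          Int.natAbs_neg]]

omit [Fintype Λ] in
/-- `f '' (s ∖ {a}) = f '' s ∖ {f a}` for `f` injective on `s`. [folklore] -/
private theorem image_erase_of_injOn {β : Type*} [DecidableEq β] {f : Λ → β} {s : Finset Λ}
    (hf : Set.InjOn f s) {a : Λ} (ha : a ∈ s) : (s.erase a).image f = (s.image f).erase (f a) := by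
  ext y
  simp only [Finset.mem_image, Finset.mem_erase]
  constructor
  · rintro ⟨b, ⟨hba, hb⟩, rfl⟩
    exact ⟨fun h => hba (hf hb ha h), b, hb, rfl⟩
  · rintro ⟨hy, b, hb, rfl⟩
    exact ⟨b, ⟨fun h => hy (by rw [h]), hb⟩, rfl⟩

/-- The ground-state functional of the torus antiferromagnet is real on `𝐒_x·𝐒_y`. [folklore] -/
private theorem im_groundStateFunctional_spinDot (L : ℕ) [NeZero L] (x y : TorusSite 2 L) :
    ((heisenbergTorus 2 L 1 1).groundStateFunctional (spinDot 1 x y)).im = 0 := by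
  have hh := groundStateFunctional_conjTranspose (heisenbergTorus 2 L 1 1) (spinDot 1 x y)
  rw [(spinDot_isHermitian 1 x y).eq] at hh
  have := congrArg Complex.im hh
  rw [Complex.star_def, Complex.conj_im] at this
  linarith

/-- **The star row in the ground state** (window form). Arms `P` and centre `c` are window points
with coordinates `< L` (so they are distinct torus sites); if `(s+a)(s+b) ≥ 0` on the admissible
values of
`2G` for `|P|` arms, then
`0 ≤ ¾|P| + ab + (2a+2b-2)·3Σ_{p∈P} c(c-p) + 3Σ_{p≠p'∈P} c(p-p')`. [cite: Anderson1951, eq. (4)] -/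
theorem heis_starRow_nat (L : ℕ) [NeZero L] (P : Finset (ℕ × ℕ)) (c : ℕ × ℕ) (hc : c ∉ P)
    (hlt : ∀ p ∈ insert c P, p.1 < L ∧ p.2 < L) (a b : ℝ)
    (hab : ∀ s, (∃ j : ℕ, j ≤ P.card ∧ j % 2 = P.card % 2 ∧ (s = (j : ℝ) / 2 ∨ s
          = -((j : ℝ) / 2) - 1)) → 0 ≤ (s + a) * (s + b)) :
    0 ≤ 3 * (P.card : ℝ) / 4 + a * b +
      (2 * a + 2 * b - 2) * (3 * ∑ p ∈ P,
        heisRedCorr2 L 1 (Int.natAbs ((c.1 : ℤ) - p.1)) (Int.natAbs ((c.2 : ℤ) - p.2))) +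
      3 * ∑ p ∈ P, ∑ q ∈ P.erase p,
        heisRedCorr2 L 1 (Int.natAbs ((p.1 : ℤ) - q.1)) (Int.natAbs ((p.2 : ℤ) - q.2)) := by
  have hinj : Set.InjOn (fun p : ℕ × ℕ => (![((p : ℕ × ℕ).1 : ZMod L),
        ((p : ℕ × ℕ).2 : ZMod L)] : TorusSite 2 L)) (insert c P : Finset (ℕ × ℕ)) :=
    windowSite_injOn L hlt
  have hinjP : Set.InjOn (fun p : ℕ × ℕ => (![((p : ℕ × ℕ).1 : ZMod L),
        ((p : ℕ × ℕ).2 : ZMod L)] : TorusSite 2 L)) (P : Set (ℕ × ℕ)) :=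
    hinj.mono (by intro p hp; exact Finset.mem_coe.mpr (Finset.mem_insert_of_mem hp))
  set Y : Finset (TorusSite 2 L) := P.image (fun p : ℕ × ℕ => (![((p : ℕ × ℕ).1 : ZMod L),
        ((p : ℕ × ℕ).2 : ZMod L)] : TorusSite 2 L)) with hY
  set x : TorusSite 2 L := (![((c : ℕ × ℕ).1 : ZMod L),
        ((c : ℕ × ℕ).2 : ZMod L)] : TorusSite 2 L) with hxdef
  have hx : x ∉ Y := by
    intro h
    rw [hY, Finset.mem_image] at h
    obtain ⟨p, hp, hpx⟩ := h
    have hpc : p = c := hinj (Finset.mem_coe.mpr (Finset.mem_insert_of_mem hp))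
      (Finset.mem_coe.mpr (Finset.mem_insert_self c P)) hpx
    exact hc (hpc ▸ hp)
  have hcard : Y.card = P.card := Finset.card_image_of_injOn hinjP
  have hab' : ∀ s, (∃ j : ℕ, j ≤ Y.card ∧ j % 2 = Y.card % 2 ∧ (s = (j : ℝ) / 2 ∨ s
        = -((j : ℝ) / 2) - 1)) → 0 ≤ (s + a) * (s + b) := by
    rw [hcard]; exact hab
  haveI : Nonempty (TorusSite 2 L) := ⟨x⟩
  have hpsd := posSemidef_heisStar_row hx a b hab'
  have h0 := groundStateFunctional_nonneg_of_posSemidef (heisenbergTorus 2 L 1 1) hpsd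
  have hH := heisenbergTorus_isHermitian 2 L 1 1
  set ω := (heisenbergTorus 2 L 1 1).groundStateFunctional with hω
  -- expand the functional
  have hexp : ω ((∑ α : Fin 3, (∑ y ∈ Y, siteSpin 1 y α) * (∑ y ∈ Y, siteSpin 1 y α) : Op _ 2)
        + ((2 * a + 2 * b - 2 : ℝ) : ℂ) • (∑ y ∈ Y, spinDot 1 x y : Op _ 2) +
      ((a * b : ℝ) : ℂ) • (1 : Op (TorusSite 2 L) 2)) =
      ((3 / 4 : ℂ) * Y.card + ∑ y ∈ Y, ∑ y' ∈ Y.erase y, ω (spinDot 1 y y')) +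
        ((2 * a + 2 * b - 2 : ℝ) : ℂ) * ∑ y ∈ Y, ω (spinDot 1 x y) + ((a * b : ℝ) : ℂ) := by
    have hω1 : ω 1 = 1 := by rw [hω]; exact groundStateFunctional_one hH
    rw [sum_setSpin_one_mul_self]
    simp only [map_add, map_smul, map_sum, hω1, smul_eq_mul, mul_one]
  rw [hexp] at h0
  obtain ⟨hre, -⟩ := Complex.nonneg_iff.mp h0
  -- rewrite the sums over the image `Y` of `P` in the torus
  have hS1 : ∑ y ∈ Y, (ω (spinDot 1 x y)).re =
      3 * ∑ p ∈ P,
        heisRedCorr2 L 1 (Int.natAbs ((c.1 : ℤ) - p.1)) (Int.natAbs ((c.2 : ℤ) - p.2)) := by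
    rw [hY, Finset.sum_image hinjP, Finset.mul_sum]
    refine Finset.sum_congr rfl fun p hp => ?_
    have hne : (![((c : ℕ × ℕ).1 : ZMod L),
          ((c : ℕ × ℕ).2 : ZMod L)] : TorusSite 2 L) ≠ (![((p : ℕ × ℕ).1 : ZMod L),
          ((p : ℕ × ℕ).2 : ZMod L)] : TorusSite 2 L) := fun h =>
      hc ((hinj (Finset.mem_coe.mpr (Finset.mem_insert_self c P))
        (Finset.mem_coe.mpr (Finset.mem_insert_of_mem hp)) h) ▸ hp)
    exact re_groundStateFunctional_spinDot_window L hne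
  have hS2 : ∑ y ∈ Y, ∑ y' ∈ Y.erase y, (ω (spinDot 1 y y')).re =
      3 * ∑ p ∈ P, ∑ q ∈ P.erase p,
        heisRedCorr2 L 1 (Int.natAbs ((p.1 : ℤ) - q.1)) (Int.natAbs ((p.2 : ℤ) - q.2)) := by
    rw [hY, Finset.sum_image hinjP, Finset.mul_sum]
    refine Finset.sum_congr rfl fun p hp => ?_
    have hinjE : Set.InjOn (fun p : ℕ × ℕ => (![((p : ℕ × ℕ).1 : ZMod L),
          ((p : ℕ × ℕ).2 : ZMod L)] : TorusSite 2 L))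
          ((P.erase p : Finset (ℕ × ℕ)) : Set (ℕ × ℕ)) :=
      hinjP.mono (by
        intro q hq; exact Finset.mem_coe.mpr (Finset.mem_of_mem_erase (Finset.mem_coe.mp hq)))
    rw [← image_erase_of_injOn hinjP hp, Finset.sum_image hinjE, Finset.mul_sum]
    refine Finset.sum_congr rfl fun q hq => ?_
    have hne : (![((p : ℕ × ℕ).1 : ZMod L),
          ((p : ℕ × ℕ).2 : ZMod L)] : TorusSite 2 L) ≠ (![((q : ℕ × ℕ).1 : ZMod L),
          ((q : ℕ × ℕ).2 : ZMod L)] : TorusSite 2 L) := fun h =>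
      (Finset.ne_of_mem_erase hq).symm (hinjP (Finset.mem_coe.mpr hp)
        (Finset.mem_coe.mpr (Finset.mem_of_mem_erase hq)) h)
    exact re_groundStateFunctional_spinDot_window L hne
  have hS1im : ∑ y ∈ Y, (ω (spinDot 1 x y)).im = 0 :=
    Finset.sum_eq_zero fun y _ => im_groundStateFunctional_spinDot L x y
  have key : (0 : ℝ) ≤ 3 / 4 * Y.card + ∑ y ∈ Y, ∑ y' ∈ Y.erase y, (ω (spinDot 1 y y')).re +
      (2 * a + 2 * b - 2) * ∑ y ∈ Y, (ω (spinDot 1 x y)).re + a * b := by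
    have e : ((3 / 4 : ℂ) * Y.card + ∑ y ∈ Y, ∑ y' ∈ Y.erase y, ω (spinDot 1 y y') +
        ((2 * a + 2 * b - 2 : ℝ) : ℂ) * ∑ y ∈ Y, ω (spinDot 1 x y) + ((a * b : ℝ) : ℂ)).re =
        3 / 4 * Y.card + ∑ y ∈ Y, ∑ y' ∈ Y.erase y, (ω (spinDot 1 y y')).re +
          (2 * a + 2 * b - 2) * ∑ y ∈ Y, (ω (spinDot 1 x y)).re + a * b := by
      simp only [Complex.add_re, Complex.mul_re, Complex.ofReal_re, Complex.ofReal_im,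
            Complex.re_sum,
        Complex.im_sum, Complex.natCast_re, Complex.natCast_im, hS1im, mul_zero, sub_zero]
      norm_num
    rw [← e]
    simpa using hre
  rw [hS1, hS2, hcard] at key
  linarith [key]

/-- **Star row, even arm number** (`n ∈ ℤ`):
`0 ≤ ¾|P| + n(n+1) + 4n·3Σ_{p∈P} c(c-p) + 3Σ_{p≠p'∈P} c(p-p')`. [cite: Anderson1951, eq. (4)] -/
theorem heis_starRow_nat_even (L : ℕ) [NeZero L] (P : Finset (ℕ × ℕ)) (c : ℕ × ℕ) (hc : c ∉ P)
    (hlt : ∀ p ∈ insert c P, p.1 < L ∧ p.2 < L) (hk : P.card % 2 = 0) (n : ℤ) :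
    0 ≤ 3 * (P.card : ℝ) / 4 + n * (n + 1) +
      (4 * n) * (3 * ∑ p ∈ P,
        heisRedCorr2 L 1 (Int.natAbs ((c.1 : ℤ) - p.1)) (Int.natAbs ((c.2 : ℤ) - p.2))) +
      3 * ∑ p ∈ P, ∑ q ∈ P.erase p,
        heisRedCorr2 L 1 (Int.natAbs ((p.1 : ℤ) - q.1)) (Int.natAbs ((p.2 : ℤ) - q.2)) := by
  have h := heis_starRow_nat L P c hc hlt n (n + 1) fun s hs => starRow_arith_even hk n s hs
  have e : (2 * (n : ℝ) + 2 * ((n : ℝ) + 1) - 2) = 4 * n := by ring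
  rw [e] at h
  exact h

/-- **Star row, odd arm number** (`n ∈ ℤ`):
`0 ≤ ¾|P| + (n+½)(n+3/2) + (4n+2)·3Σ_{p∈P} c(c-p) + 3Σ_{p≠p'∈P} c(p-p')`.
[cite: Anderson1951, eq. (4)] -/
theorem heis_starRow_nat_odd (L : ℕ) [NeZero L] (P : Finset (ℕ × ℕ)) (c : ℕ × ℕ) (hc : c ∉ P)
    (hlt : ∀ p ∈ insert c P, p.1 < L ∧ p.2 < L) (hk : P.card % 2 = 1) (n : ℤ) :
    0 ≤ 3 * (P.card : ℝ) / 4 + (n + 1 / 2) * (n + 3 / 2) +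
      (4 * n + 2) * (3 * ∑ p ∈ P,
        heisRedCorr2 L 1 (Int.natAbs ((c.1 : ℤ) - p.1)) (Int.natAbs ((c.2 : ℤ) - p.2))) +
      3 * ∑ p ∈ P, ∑ q ∈ P.erase p,
        heisRedCorr2 L 1 (Int.natAbs ((p.1 : ℤ) - q.1)) (Int.natAbs ((p.2 : ℤ) - q.2)) := by
  have h := heis_starRow_nat L P c hc hlt (n + 1 / 2) (n + 3 / 2)
    fun s hs => starRow_arith_odd hk n s hs
  have e : (2 * ((n : ℝ) + 1 / 2) + 2 * ((n : ℝ) + 3 / 2) - 2) = 4 * n + 2 := by ring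
  rw [e] at h
  exact h

end Torus

end Literature.MathematicalPhysics.QuantumLattice
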